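import Literature.MathematicalPhysics.QuantumFieldTheory.Balaban1983to89.Beta.AxialDressing
import Literature.MathematicalPhysics.QuantumFieldTheory.Balaban1983to89.Beta.RootedComb

/-!
# The ROOTED axial dressing `Πᵀ_ρ` — part 1: the transpose matrix of the rooted projector, its window operator,
bounds and coarse-translation covariance

HONEST FRAMING (cell charter, verbatim): «discharging BetaPertH makes Balaban's UV stability UNCONDITIONAL — a real
constructive-QFT result; it is NOT the continuum limit and NOT the Clay problem.»  This file is a DERIVED cell leaf
(pub-balaban β sub-cell, lane an2, work-order (P7′) of the β lead: RULINGS (R32-4), (R33-A-2), (R33-A-2′), (R34-A)); it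
types no statement of Bałaban's papers, carries no `[cite:]` tag, mints no `Prop` fact, and instantiates no binder of
the β-function wall by itself.  NOT `BetaPertH`; NOT continuum; NOT Clay.

## What is here

an2's axial dressing `AxialDressing.dress` dresses the undressed jets by `Πᵀ = coProj N`, the transpose of the axial
projector `Π = AxialProjector.axProj N` of the comb ROOTED AT THE BLOCK BASE POINT `N•blk x` (axis order `0 < 1 < … < d`).
Bałaban's averaging contours are rooted at the block CENTRE; an1 (`AveragingContoursRooted`, `treeGaugeAt ρ`) and an5
(`RootedComb`, `axProjAt ρ`) re-typed the comb and its projector for an ARBITRARY root offset `ρ` (block `B(y) = N•y + box`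
UNCHANGED, root `N•y + ρ`).  This leaf supplies the matching TRANSPOSE for the jets:

* §1 `bondInd`, `pm ρ N β p α q := (Π^ρ δ_{(α,q)})_β(p)` — the MATRIX of the rooted projector (ℤ-valued), the offset
  window `cube n N = {v : |v_i| ≤ N}` and the window operator on real one-forms
  `coProjAt ρ N g α q := Σ_{v ∈ cube} Σ_β pm ρ N β (q+v) α q · g β (q+v)` (`Πᵀ_ρ` restricted to the window; that the
  window carries the whole transpose — the comb from an in-block root never leaves the block — is the adjunction of
  part 3, not used here);
* §2 letters of axial contours and the bound `|pm| ≤ 1 + 2·n·N` for in-block roots `ρ = toSite r`, hence the sup bound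
  `|coProjAt ρ N g α q| ≤ cW n N · M`;
* §3 coarse-translation covariance: `treeGaugeAt_shift`, `axProjAt_shift` (ρ-twins of `AxialProjector.treeGauge_shift` /
  `axProj_shift`), `pm_shift`, `coProjAt_shift` (twin of `AxialDressing.coProj_shift`).

Part 2 (`AxialDressingRootedLegs`) builds the leg dressings, the bond slot and the functor `dressAt` on `JetData` with the
translation sockets; part 3 (`AxialDressingRootedBridge`) certifies faithfulness at the base root:
`coProjAt 0 N g = coProj N g`.

Design note ((R32-4) «cheapest faithful form»): the rooted transpose is NOT a translate of the base-rooted one (centre- and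
corner-rooted combs are not related by a block bijection, cf. the `RootedComb` header), so it is re-typed — but as the
literal transpose matrix of an5's landed `axProjAt`, not by re-deriving `AxialProjector` §9–§11's signed path incidence
for two-directional comb paths.  All declarations `[folklore]` (finite sums, lattice bookkeeping); axioms standard.

Provenance: b2b-balaban β sub-cell, unit beta-an2 gen 11, 2026-08-19 (v1); over `Beta.AxialDressing` (an2 lineage, v1.4)
and `Beta.RootedComb` (an5 lineage, v1) BY NAME; no existing file touched.
-/

open Finset
open scoped BigOperators
open Literature.MathematicalPhysics.QuantumFieldTheory
open Literature.MathematicalPhysics.QuantumFieldTheory.Balaban1983to89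
open Literature.MathematicalPhysics.QuantumFieldTheory.Balaban1983to89.Beta
open B12Sec2to5 (l1 l1_nonneg)
open AffineAveraging (Form0 Form1 unitVec unitVec_apply box toSite)
open AveragingContours (blk shift segUp segDown seg axialAux axial axial_length axial_add grad)
open AveragingContoursRooted (treeGaugeAt)
open RootedComb (axProjAt axProjAt_apply axProjAt_zero)
open AxialProjector (zsmul_blk_le lt_zsmul_blk_add blk_add_zsmul)

namespace Summit.QuantumFields.BalabanUV.Beta.AxialDressingRooted

variable {n : ℕ}

/-! ## §1 The matrix of the rooted projector and the window operator -/

section Matrix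

/-- [folklore] The ℤ-valued indicator one-form of the bond `(α, q)`. -/
def bondInd (α : Fin n) (q : Fin n → ℤ) : Form1 n ℤ := fun β p => if β = α ∧ p = q then 1 else 0

/-- [folklore] Pointwise form of `bondInd`. -/
theorem bondInd_apply (α : Fin n) (q : Fin n → ℤ) (β : Fin n) (p : Fin n → ℤ) :
    bondInd α q β p = if β = α ∧ p = q then 1 else 0 := rfl

/-- [folklore] `|bondInd| ≤ 1`. -/
theorem abs_bondInd_le (α : Fin n) (q : Fin n → ℤ) (β : Fin n) (p : Fin n → ℤ) : |bondInd α q β p| ≤ 1 := by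
  rw [bondInd_apply]
  split <;> simp

/-- [folklore] **THE MATRIX OF THE ROOTED PROJECTOR**: `pm ρ N β p α q := (Π^ρ δ_{(α,q)})_β(p)`, i.e. the `((β,p),(α,q))`
entry of `Π^ρ = RootedComb.axProjAt ρ N`; read with the roles of the two bonds exchanged it is the `((α,q),(β,p))`
entry of the transpose `Πᵀ_ρ`. -/
noncomputable def pm (ρ : Fin n → ℤ) (N : ℕ) (β : Fin n) (p : Fin n → ℤ) (α : Fin n) (q : Fin n → ℤ) : ℤ :=
  axProjAt ρ N (bondInd α q) β p

/-- [folklore] `pm` unfolds to the rooted projector of the bond indicator. -/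
theorem pm_eq (ρ : Fin n → ℤ) (N : ℕ) (β : Fin n) (p : Fin n → ℤ) (α : Fin n) (q : Fin n → ℤ) :
    pm ρ N β p α q = axProjAt ρ N (bondInd α q) β p := rfl

/-- [folklore] The window of offsets `{v : |v_i| ≤ N for all i}`. -/
noncomputable def cube (n N : ℕ) : Finset (Fin n → ℤ) := Fintype.piFinset fun _ => Finset.Icc (-(N : ℤ)) N

/-- [folklore] Membership in the window. -/
theorem mem_cube {N : ℕ} {v : Fin n → ℤ} : v ∈ cube n N ↔ ∀ i, |v i| ≤ N := by
  simp only [cube, Fintype.mem_piFinset, Finset.mem_Icc, abs_le]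

/-- [folklore] `0` is in the window. -/
theorem zero_mem_cube (N : ℕ) : (0 : Fin n → ℤ) ∈ cube n N :=
  mem_cube.2 fun i => by simp

/-- [folklore] The window has `(2N+1)^n` points. -/
theorem card_cube (n N : ℕ) : (cube n N).card = (2 * N + 1) ^ n := by
  rw [cube, Fintype.card_piFinset]
  simp only [Int.card_Icc, Finset.prod_const, Finset.card_univ, Fintype.card_fin]
  congr 1
  have e : (N : ℤ) + 1 - -(N : ℤ) = ((2 * N + 1 : ℕ) : ℤ) := by
    push_cast
    ring
  rw [e, Int.toNat_natCast]

/-- [folklore] Window offsets have `ℓ¹`-norm `≤ n·N`. -/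
theorem l1_le_of_mem_cube {N : ℕ} {v : Fin n → ℤ} (hv : v ∈ cube n N) : l1 v ≤ (n : ℝ) * N := by
  unfold l1
  calc ∑ i : Fin n, |((v i : ℤ) : ℝ)| ≤ ∑ _i : Fin n, (N : ℝ) := Finset.sum_le_sum fun i _ => by
          have h1 : |v i| ≤ (N : ℤ) := mem_cube.1 hv i
          have h2 : ((|v i| : ℤ) : ℝ) ≤ (N : ℝ) := by exact_mod_cast h1
          rw [Int.cast_abs] at h2
          exact h2
    _ = (n : ℝ) * N := by
        rw [Finset.sum_const, Finset.card_univ, Fintype.card_fin, nsmul_eq_mul]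

/-- [folklore] `ℓ¹` is even. -/
theorem l1_neg (v : Fin n → ℤ) : l1 (-v) = l1 v := by
  unfold l1
  refine Finset.sum_congr rfl fun i _ => ?_
  rw [Pi.neg_apply, Int.cast_neg, abs_neg]

/-- [folklore] **THE WINDOW OPERATOR `Πᵀ_ρ` ON REAL ONE-FORMS**: `(Πᵀ_ρ g)_α(q) = Σ_{v ∈ cube} Σ_β pm ρ N β (q+v) α q · g_β(q+v)`. -/
noncomputable def coProjAt (ρ : Fin n → ℤ) (N : ℕ) (g : Form1 n ℝ) : Form1 n ℝ :=
  fun α q => ∑ v ∈ cube n N, ∑ β : Fin n, (pm ρ N β (q + v) α q : ℝ) * g β (q + v)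

/-- [folklore] Pointwise form of `coProjAt`. -/
theorem coProjAt_apply (ρ : Fin n → ℤ) (N : ℕ) (g : Form1 n ℝ) (α : Fin n) (q : Fin n → ℤ) :
    coProjAt ρ N g α q = ∑ v ∈ cube n N, ∑ β : Fin n, (pm ρ N β (q + v) α q : ℝ) * g β (q + v) := rfl

end Matrix

/-! ## §2 Letters of axial contours; the matrix and the window operator are bounded -/

section Letters

variable {R : Type*}

/-- [folklore] Letters of an upward segment are values of the form. -/
theorem mem_segUp {A : Form1 n R} {z : Fin n → ℤ} {κ : Fin n} {m : ℕ} {a : R} (h : a ∈ segUp A z κ m) :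
    ∃ z' : Fin n → ℤ, a = A κ z' := by
  simp only [segUp, List.mem_map] at h
  obtain ⟨s, -, hs⟩ := h
  exact ⟨_, hs.symm⟩

/-- [folklore] Letters of a downward segment are negated values of the form. -/
theorem mem_segDown [AddCommGroup R] {A : Form1 n R} {z : Fin n → ℤ} {κ : Fin n} {m : ℕ} {a : R} (h : a ∈ segDown A z κ m) :
    ∃ z' : Fin n → ℤ, a = -A κ z' := by
  simp only [segDown, List.mem_map] at h
  obtain ⟨s, -, hs⟩ := h
  exact ⟨_, hs.symm⟩

/-- [folklore] Letters of a segment are `±` values of the form. -/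
theorem mem_seg [AddCommGroup R] {A : Form1 n R} {z : Fin n → ℤ} {κ : Fin n} {m : ℤ} {a : R} (h : a ∈ seg A z κ m) :
    ∃ z' : Fin n → ℤ, a = A κ z' ∨ a = -A κ z' := by
  unfold seg at h
  split at h
  · obtain ⟨z', e⟩ := mem_segUp h
    exact ⟨z', Or.inl e⟩
  · obtain ⟨z', e⟩ := mem_segDown h
    exact ⟨z', Or.inr e⟩

/-- [folklore] Letters of the partial axial contours are `±` values of the form. -/
theorem mem_axialAux [AddCommGroup R] {A : Form1 n R} {y x : Fin n → ℤ} {a : R} :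
    ∀ {m : ℕ}, a ∈ axialAux A y x m → ∃ (κ : Fin n) (z' : Fin n → ℤ), a = A κ z' ∨ a = -A κ z'
  | 0, h => by simp [axialAux] at h
  | m + 1, h => by
    simp only [axialAux, List.mem_append] at h
    rcases h with h | h
    · split at h
      · obtain ⟨z', e⟩ := mem_seg h
        exact ⟨_, z', e⟩
      · simp at h
    · exact mem_axialAux h

/-- [folklore] **LETTERS OF THE AXIAL CONTOUR** `Γ_{y,x}` are `±A_κ(z)`. -/
theorem mem_axial [AddCommGroup R] {A : Form1 n R} {y x : Fin n → ℤ} {a : R} (h : a ∈ axial A y x) :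
    ∃ (κ : Fin n) (z' : Fin n → ℤ), a = A κ z' ∨ a = -A κ z' :=
  mem_axialAux h

end Letters

section Bounds

/-- [folklore] An integer list with letters in `[−1, 1]` has `|sum| ≤ length`. -/
theorem abs_list_sum_le_length {l : List ℤ} (h : ∀ a ∈ l, |a| ≤ 1) : |l.sum| ≤ (l.length : ℤ) := by
  induction l with
  | nil => simp
  | cons a t ih =>
    simp only [List.sum_cons, List.length_cons, Nat.cast_add, Nat.cast_one]
    have ha : |a| ≤ 1 := h a (by simp)
    have ht : |t.sum| ≤ (t.length : ℤ) := ih fun b hb => h b (by simp [hb])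
    calc |a + t.sum| ≤ |a| + |t.sum| := abs_add_le _ _
      _ ≤ 1 + (t.length : ℤ) := add_le_add ha ht
      _ = (t.length : ℤ) + 1 := add_comm _ _

/-- [folklore] From an IN-BLOCK root the axial contour to a point of the block has at most `n·N` bonds. -/
theorem axial_length_le_of_root {N : ℕ} (hN : 1 ≤ N) {r : Fin n → ℕ} (hr : r ∈ box n N) {R : Type*} [AddCommGroup R]
    (A : Form1 n R) (z : Fin n → ℤ) : (axial A ((N : ℤ) • blk N z + toSite r) z).length ≤ n * N := by
  rw [axial_length]
  calc ∑ i : Fin n, (z i - ((N : ℤ) • blk N z + toSite r) i).natAbs ≤ ∑ _i : Fin n, N :=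
        Finset.sum_le_sum fun i _ => by
          have a1 := zsmul_blk_le hN z i
          have a2 := lt_zsmul_blk_add hN z i
          have hri : r i < N := Finset.mem_range.1 (Fintype.mem_piFinset.1 hr i)
          have hri' : ((r i : ℕ) : ℤ) < N := by exact_mod_cast hri
          have h0 : (0 : ℤ) ≤ ((r i : ℕ) : ℤ) := by positivity
          have e : ((N : ℤ) • blk N z + toSite r) i = ((N : ℤ) • blk N z) i + ((r i : ℕ) : ℤ) := by
            simp only [Pi.add_apply, toSite]
          have key : ((z i - ((N : ℤ) • blk N z + toSite r) i).natAbs : ℤ) ≤ (N : ℤ) := by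
            rw [Int.natCast_natAbs, e]
            exact abs_le.2 ⟨by linarith, by linarith⟩
          exact_mod_cast key
    _ = n * N := by
        rw [Finset.sum_const, Finset.card_univ, Fintype.card_fin, smul_eq_mul]

/-- [folklore] The rooted tree integral of a bond indicator is bounded by the contour length: `|λ^ρ_{δ}(z)| ≤ n·N`. -/
theorem abs_treeGaugeAt_bondInd_le {N : ℕ} (hN : 1 ≤ N) {r : Fin n → ℕ} (hr : r ∈ box n N) (α : Fin n)
    (q z : Fin n → ℤ) : |treeGaugeAt (toSite r) (bondInd α q) N z| ≤ (n : ℤ) * N := by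
  unfold treeGaugeAt
  have h1 : ∀ a ∈ axial (bondInd α q) ((N : ℤ) • blk N z + toSite r) z, |a| ≤ 1 := by
    intro a ha
    obtain ⟨κ, z', e | e⟩ := mem_axial ha
    · rw [e]
      exact abs_bondInd_le α q κ z'
    · rw [e, abs_neg]
      exact abs_bondInd_le α q κ z'
  have h2 := abs_list_sum_le_length h1
  have h3 : ((axial (bondInd α q) ((N : ℤ) • blk N z + toSite r) z).length : ℤ) ≤ (n : ℤ) * N := by
    exact_mod_cast axial_length_le_of_root hN hr (bondInd α q) z
  exact h2.trans h3

/-- [folklore] **THE MATRIX IS BOUNDED**: `|pm ρ N β p α q| ≤ 1 + 2·n·N` for in-block roots. -/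
theorem abs_pm_le {N : ℕ} (hN : 1 ≤ N) {r : Fin n → ℕ} (hr : r ∈ box n N) (β : Fin n) (p : Fin n → ℤ) (α : Fin n)
    (q : Fin n → ℤ) : |pm (toSite r) N β p α q| ≤ 1 + 2 * ((n : ℤ) * N) := by
  rw [pm_eq, axProjAt_apply]
  have h0 := abs_bondInd_le α q β p
  have h1 := abs_treeGaugeAt_bondInd_le hN hr α q (p + unitVec β)
  have h2 := abs_treeGaugeAt_bondInd_le hN hr α q p
  calc |bondInd α q β p - (treeGaugeAt (toSite r) (bondInd α q) N (p + unitVec β)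
          - treeGaugeAt (toSite r) (bondInd α q) N p)|
      ≤ |bondInd α q β p| + |treeGaugeAt (toSite r) (bondInd α q) N (p + unitVec β)
          - treeGaugeAt (toSite r) (bondInd α q) N p| := abs_sub _ _
    _ ≤ |bondInd α q β p| + (|treeGaugeAt (toSite r) (bondInd α q) N (p + unitVec β)|
          + |treeGaugeAt (toSite r) (bondInd α q) N p|) := add_le_add le_rfl (abs_sub _ _)
    _ ≤ 1 + ((n : ℤ) * N + (n : ℤ) * N) := add_le_add h0 (add_le_add h1 h2)
    _ = 1 + 2 * ((n : ℤ) * N) := by ring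

/-- [folklore] The same bound, cast to `ℝ`. -/
theorem abs_pm_le_real {N : ℕ} (hN : 1 ≤ N) {r : Fin n → ℕ} (hr : r ∈ box n N) (β : Fin n) (p : Fin n → ℤ)
    (α : Fin n) (q : Fin n → ℤ) : |(pm (toSite r) N β p α q : ℝ)| ≤ 1 + 2 * ((n : ℝ) * N) := by
  have h := abs_pm_le hN hr β p α q
  have h' : ((|pm (toSite r) N β p α q| : ℤ) : ℝ) ≤ ((1 + 2 * ((n : ℤ) * N) : ℤ) : ℝ) := by exact_mod_cast h
  rw [Int.cast_abs] at h'
  push_cast at h'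
  exact h'

/-- [folklore] The window constant `cW n N := (2N+1)^n · n · (1 + 2·n·N)` (number of window bonds × matrix bound). -/
noncomputable def cW (n N : ℕ) : ℝ := (((2 * N + 1) ^ n : ℕ) : ℝ) * ((n : ℝ) * (1 + 2 * ((n : ℝ) * N)))

/-- [folklore] `0 ≤ cW`. -/
theorem cW_nonneg (n N : ℕ) : 0 ≤ cW n N := by
  unfold cW
  positivity

/-- [folklore] **SUP BOUND FOR `Πᵀ_ρ`:** `|(Πᵀ_ρ g)_α(q)| ≤ cW·M` if `|g| ≤ M` on the window bonds at `q` (in-block root). -/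
theorem abs_coProjAt_le {N : ℕ} (hN : 1 ≤ N) {r : Fin n → ℕ} (hr : r ∈ box n N) (g : Form1 n ℝ) (α : Fin n)
    (q : Fin n → ℤ) {M : ℝ} (hM : ∀ (κ : Fin n) (v : Fin n → ℤ), v ∈ cube n N → |g κ (q + v)| ≤ M) :
    |coProjAt (toSite r) N g α q| ≤ cW n N * M := by
  rw [coProjAt_apply]
  calc |∑ v ∈ cube n N, ∑ β : Fin n, (pm (toSite r) N β (q + v) α q : ℝ) * g β (q + v)|
      ≤ ∑ v ∈ cube n N, |∑ β : Fin n, (pm (toSite r) N β (q + v) α q : ℝ) * g β (q + v)| :=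
        Finset.abs_sum_le_sum_abs _ _
    _ ≤ ∑ v ∈ cube n N, ∑ _β : Fin n, (1 + 2 * ((n : ℝ) * N)) * M :=
        Finset.sum_le_sum fun v hv => (Finset.abs_sum_le_sum_abs _ _).trans
          (Finset.sum_le_sum fun β _ => by
            rw [abs_mul]
            exact mul_le_mul (abs_pm_le_real hN hr β (q + v) α q) (hM β v hv) (abs_nonneg _) (by positivity))
    _ = cW n N * M := by
        rw [Finset.sum_const, Finset.sum_const, Finset.card_univ, Fintype.card_fin, card_cube]
        simp only [nsmul_eq_mul]
        unfold cW
        push_cast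
        ring

end Bounds

/-! ## §3 Coarse-translation covariance of the rooted tree gauge, projector, matrix and window operator -/

section Shift

variable {R : Type*} [AddCommGroup R]

/-- [folklore] The rooted tree integral commutes with COARSE translations (ρ-twin of `AxialProjector.treeGauge_shift`). -/
theorem treeGaugeAt_shift (ρ : Fin n → ℤ) {N : ℕ} (hN : 1 ≤ N) (A : Form1 n R) (x v : Fin n → ℤ) :
    treeGaugeAt ρ A N (x + (N : ℤ) • v) = treeGaugeAt ρ (shift ((N : ℤ) • v) A) N x := by
  unfold treeGaugeAt
  rw [blk_add_zsmul hN, smul_add,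
    show (N : ℤ) • blk N x + (N : ℤ) • v + ρ = ((N : ℤ) • blk N x + ρ) + (N : ℤ) • v from by abel, axial_add]

/-- [folklore] **`Π^ρ` COMMUTES WITH COARSE TRANSLATIONS** (ρ-twin of `AxialProjector.axProj_shift`). -/
theorem axProjAt_shift (ρ : Fin n → ℤ) {N : ℕ} (hN : 1 ≤ N) (A : Form1 n R) (v : Fin n → ℤ) :
    axProjAt ρ N (shift ((N : ℤ) • v) A) = shift ((N : ℤ) • v) (axProjAt ρ N A) := by
  funext κ x
  show axProjAt ρ N (shift ((N : ℤ) • v) A) κ x = axProjAt ρ N A κ (x + (N : ℤ) • v)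
  rw [axProjAt_apply, axProjAt_apply, ← treeGaugeAt_shift ρ hN, ← treeGaugeAt_shift ρ hN,
    add_right_comm x (unitVec κ) ((N : ℤ) • v)]
  rfl

/-- [folklore] Translating the bond translates the indicator form. -/
theorem bondInd_shift (α : Fin n) (q w : Fin n → ℤ) : bondInd α (q + w) = shift (-w) (bondInd α q) := by
  funext κ x
  show bondInd α (q + w) κ x = bondInd α q κ (x + -w)
  simp only [bondInd_apply]
  by_cases h1 : x = q + w
  · have h2 : q + w + -w = q := by abel
    simp only [h1, h2, and_true]
  · have h2 : ¬ (x + -w = q) := fun h => h1 (by rw [← h]; abel)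
    simp only [h1, h2, and_false]

/-- [folklore] **THE MATRIX IS COARSE-TRANSLATION INVARIANT**: `pm ρ N β (p + N•z) α (q + N•z) = pm ρ N β p α q`. -/
theorem pm_shift (ρ : Fin n → ℤ) {N : ℕ} (hN : 1 ≤ N) (β : Fin n) (p : Fin n → ℤ) (α : Fin n) (q z : Fin n → ℤ) :
    pm ρ N β (p + (N : ℤ) • z) α (q + (N : ℤ) • z) = pm ρ N β p α q := by
  rw [pm_eq, pm_eq, bondInd_shift, show -((N : ℤ) • z) = (N : ℤ) • (-z) from (smul_neg _ _).symm,
    axProjAt_shift ρ hN]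
  show axProjAt ρ N (bondInd α q) β (p + (N : ℤ) • z + (N : ℤ) • -z) = axProjAt ρ N (bondInd α q) β p
  rw [smul_neg, add_neg_cancel_right]

/-- [folklore] **`Πᵀ_ρ` IS COARSE-TRANSLATION COVARIANT**: `Πᵀ_ρ (g ∘ shift (N•z)) (α, q) = (Πᵀ_ρ g)(α, q + N•z)`
(twin of `AxialDressing.coProj_shift`). -/
theorem coProjAt_shift (ρ : Fin n → ℤ) {N : ℕ} (hN : 1 ≤ N) (g : Form1 n ℝ) (z : Fin n → ℤ) (α : Fin n)
    (q : Fin n → ℤ) :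
    coProjAt ρ N (fun κ u => g κ (u + (N : ℤ) • z)) α q = coProjAt ρ N g α (q + (N : ℤ) • z) := by
  rw [coProjAt_apply, coProjAt_apply]
  refine Finset.sum_congr rfl fun v _ => Finset.sum_congr rfl fun β _ => ?_
  rw [add_right_comm q ((N : ℤ) • z) v, pm_shift ρ hN]

end Shift

end Summit.QuantumFields.BalabanUV.Beta.AxialDressingRooted
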